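import Literature.MathematicalPhysics.QuantumFieldTheory.Balaban1983to89.B4Ineq120TorusRegular
import Literature.MathematicalPhysics.QuantumFieldTheory.Balaban1983to89.B4Prop23RegularWindow

/-!
# `Balaban1983to89.B4Prop23TorusFamily` — [Balaban1983RegularityDecay] «PROPOSITION 2.3 OF [1]» (1.15)–(1.20) p. 574:
# the typed statement `B4.Prop23Printed` DISCHARGED ON THE FAMILY OF REGULAR-FIELD NESTED REGIONS OF THE DISCRETE TORUS
# (`A ≠ 0`, running coefficient `a_k ∈ [a₋(1−L⁻²), a₊]`, ONE set of constants) — the torus twin of p17's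
# `B4Prop23RegularWindow.prop23Printed_regularWindow`

statement-level skeleton of published theorems with citation tags; proofs where landed; nothing here is a claim about the Yang–Mills mass gap

CITATION HEADER.  T. Bałaban, *Regularity and decay of lattice Green's functions*, Commun. Math. Phys. **89** (1983)
571–597, doi:10.1007/bf01214744 [Balaban1983RegularityDecay] (cell paper B4; held text
`paper:balaban1983-cmp89-regularity-decay`, journal page = PDF page + 570; pp. 572–574, 580–581, 593–594).  Cell
`pub-ymgap`, Track-A seat `pub-ymgap-dag-p3` gen 2 (node N01 of YM-PLAN §2).  PURPOSE (located flag F-torusU of YM-PLAN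
row N01, XREAD-B4 v0.5 §6: «famU of record is typed on regions of `ηℤ^{d+1}`, not torus regions — print's primary setting
p. 572; ADMIT R325 D2»): THIS module types the TORUS `famU` — a family of b04's `B4.UnitSetting` indexed by torus regions
at a (1.7)-regular torus field — and proves `B4.Prop23Printed` on it (files 1–3 of this seat: `B4Ineq115TorusRegular`
(1.15), `B4Prop23TorusRegular` (1.16)–(1.18), `B4Ineq120TorusRegular` (1.19)–(1.20), all on r01's torus carrier
`B4TorusRegionOp.torusOp`).  DEFINITIONS with bodies (review lane): the index `TorusRegIdxW`, the family
`torusFieldRegionsW`, the weight `tdistCT` (`dist_T(y, Λ^c)`); theorems otherwise; no `Prop`-valued fact, no `sorry`;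
axioms standard.

WHAT IS PRINTED (p. 574 [PDF 4], verbatim).  «Proposition 2.3 of [1]. There exist positive constants δ₀, c₀, γ₀, γ₁
dependent on d and M only and such that for arbitrary Λ ⊂ Ω^{(k)} = Ω∩Z^d, Λ being a sum of big blocks and for e
sufficiently small, we have γ₀I ≤ Δ^{(k)}(Ω, A) + aL^{−2}P(A) ≤ γ₁I, (1.15) |C^{(k)}_Λ(Ω, A; x, x′)| ≤ c₀ exp(−δ₀|x − x′|),
x, x′ ∈ Λ. (1.16) In particular the above inequality holds for C^{(k)}(Ω, A). Putting δC^{(k)}_Λ(Ω, A) = C^{(k)}_Λ(Ω, A) −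
C^{(k)}(Ω, A), (1.17) we have also |δC^{(k)}_Λ(Ω, A; x, x′)| ≤ c₀ exp(−δ₀(|x − x′| + dist(x, Λ^c) + dist(x′, Λ^c))),
x, x′ ∈ Λ. (1.18) Finally, for Ω ⊂ Ω₀ and δC^{(k)}_Λ(Ω, Ω₀, A) = C^{(k)}_Λ(Ω, A) − C^{(k)}_Λ(Ω₀, A), (1.19) we have
|δC^{(k)}_Λ(Ω, Ω₀, A; x, x′)| ≤ c₀ exp(−δ₀(|x − x′| + dist(x, Ω^{(k)c}) + dist(x′, Ω^{(k)c}))), x, x′ ∈ Λ. (1.20)»;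
p. 572: «Another common case is to consider operators on subsets of a torus T_η which we identify with a rectangular
parallelepiped in ηZ^d with periodic conditions.»; p. 573: «a_k is a constant proportional to a».

THE FAMILY (`TorusRegIdxW`, `torusFieldRegionsW`; dictionary of files 1–3).  Fixed for the family: `d`, the colour type
`ι`, an orthogonal flow `F` with Lipschitz constant `ℓ₁`, the block side `L = ℓ+1 ≥ 2`, windows `[a₋, a₊] ∋ a` (`a₋ > 0`)
and `[0, m²₊] ∋ m²`, the coefficient `a′ > 0` of `a′L^{−2}P`, the (1.7) constants `(c, β)`.  ONE INSTANCE = a scale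
`k ≥ 1` (mesh `n = L^k`); a unit torus `Π_ν ℤ/(L·P′_ν)` (`P′_ν ≥ 1`, fine period `≥ 3`); NESTED unions `Ω^{(k)} = fineDom L
Z_T ⊆ Ω₀^{(k)} = fineDom L Z₀_T` of its `L`-blocks; a finite `Λ ⊆ Ω^{(k)} × {colours}`; `a ∈ [a₋,a₊]` (the running
coefficient of (1.14) is `a_k = aSeq a L k`, p. 573); `m²`; a torus field `A`; the charge `e`.  Carrier: `LSite = Λ`;
`regular` = (1.7) with torus differences on the fine region of `Ω₀`; `bigBlocks = True` (no big-block condition is used: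
Corollary 2.3 on the torus holds for every block size); `udist` = `rhoT` (torus sup-distance of unit sites); `distLc` =
`tdistCT` (`dist_T(·, Λ^c)` read inside `Ω^{(k)} × ι`); `distOc` = `omegaT` (`dist_T(·, T^{(k)}∖Ω^{(k)})`); `kerC`, `kerDC`,
`kerDC0` = entries of r01's `cLam` at the torus form matrix of `Ω` (and, for (1.19), of `Ω₀` ON `Ω₀`'S OWN CARRIERS at
`ιΛ`, `lamEquiv` — identified with the ambient form matrix `ham0T` by `cLam_ambient_eqT`); `form115` = (1.15) for the torus
operator of `Ω`.

WHAT THIS MODULE PROVES (all in full).  §1 window constants and weakenings; §2 `TorusRegIdxW`, `tdistCT`,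
`torusFieldRegionsW`, `cLam_ambient_eqT`; §3 **`prop23Printed_torusRegionsW : B4.Prop23Printed (torusFieldRegionsW …)`**
— ONE `(δ₀, c₀, γ₀, γ₁, e₁)` for the whole family: `γ₀ = γ₀″(a₋(1−L⁻²))` (p17's `gamLow`, by `gamLow_mono` over
`a_k ∈ [a₋(1−L⁻²), a₊]`, `B1.ainf_lt_aSeq`/`aSeq_le`), `γ₁ = a₊ + a′L^{−2}`, `c₀ = cSt`, `δ₀ = dSt` of the Sect. 5 Theorem
at the window constants, `e₁` = min of r01 g10's Corollary-2.3 threshold and p17's three window thresholds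
(`threshold_window`, `thresholdU_window`, `hX_window`); `torusRegionsW_nonvacuous`; §5 `leafNN_torusPairFam_torusU` — the
four conjuncts of the DAG leaf `b4` (NN form) with r01 g9's torus famE AND this torus famU (r01's `leafNN_torusPairFam` with
its second conjunct moved to the torus).
HONEST SCOPE.  A MODEL INSTANCE of the typed statement on r01's torus carrier: constants depend on
`(d, N, ℓ₁, L, a₋, a₊, a′, c, β, m²₊)` (print: «d and M only»; the window/`L` dependence is p17's census item D-b04.4); the
mesh is `n = L^k` and `a_k = aSeq a L k` (forced by r01 g10's family); (1.7) is taken on the fine region of `Ω₀`;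
`dist(x, Λ^c)` is read inside `Ω^{(k)} × {colours}` and `dist(x, Ω^{(k)c})` in the unit torus; no big-block condition.
Count-neutral for YM-PLAN (typed 28∕28 · discharged 0∕28 unmoved; a re-pin of N01's famU is the leads'/node00-def's
decision, not made here); nothing here concerns the continuum, ℝ⁴, OS axioms, a mass gap or the Clay problem.
-/

namespace Literature.MathematicalPhysics.QuantumFieldTheory.Balaban1983to89.B4Prop23TorusFamily

open Finset Matrix
open Literature.MathematicalPhysics.QuantumFieldTheory.Balaban1983to89
open Literature.MathematicalPhysics.QuantumFieldTheory.Balaban1983to89.B4GaugeCovariance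
open Literature.MathematicalPhysics.QuantumFieldTheory.Balaban1983to89.B4GaussRep36 (kForm gk pOp cLam cOpLam)
open Literature.MathematicalPhysics.QuantumFieldTheory.Balaban1983to89.B4Sect5Torus (IsPseudoDist SumBound cSt dSt Hyp56
  Hyp59 cSt_pos dSt_pos)
open Literature.MathematicalPhysics.QuantumFieldTheory.Balaban1983to89.B4Reflection242 (boxDom)
open Literature.MathematicalPhysics.QuantumFieldTheory.Balaban1983to89.B4Lower18 (fineDom mem_fineDom)
open Literature.MathematicalPhysics.QuantumFieldTheory.Balaban1983to89.B4Lower18Regular (e1)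
open Literature.MathematicalPhysics.QuantumFieldTheory.Balaban1983to89.B4RegionCubeCarrier (fineDom_mono)
open Literature.MathematicalPhysics.QuantumFieldTheory.Balaban1983to89.B4Cor23Region (bl2n)
open Literature.MathematicalPhysics.QuantumFieldTheory.Balaban1983to89.B4Cor23Rep36Bridge (QkR bl2n_sq)
open Literature.MathematicalPhysics.QuantumFieldTheory.Balaban1983to89.B4NextAvg52 (nextAvg rowOrtho_nextAvg)
open Literature.MathematicalPhysics.QuantumFieldTheory.Balaban1983to89.B4Prop23BlockAvg (abs_pOp_le_one)
open Literature.MathematicalPhysics.QuantumFieldTheory.Balaban1983to89.B4Prop23Sect5Route (hyp56_kOp abs_kOp_apply_le_exp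
  abs_deltaK_sub_apply_le_exp hyp59_deltaK_sub prop23_of_sect5)
open Literature.MathematicalPhysics.QuantumFieldTheory.Balaban1983to89.B4Prop23RegularRegion (profK profK_nonneg suppK
  QkR_row_support QkR_row_sq)
open Literature.MathematicalPhysics.QuantumFieldTheory.Balaban1983to89.B4Prop23RegularFamily (embY lamEquiv)
open Literature.MathematicalPhysics.QuantumFieldTheory.Balaban1983to89.B4Ineq53RegularRegion (gam0 gamLow gamLow_pos
  gam0_pos)
open Literature.MathematicalPhysics.QuantumFieldTheory.Balaban1983to89.B4ConstantsWindow (gamLow_mono threshold_window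
  thresholdU_window hX_window)
open Literature.MathematicalPhysics.QuantumFieldTheory.Balaban1983to89.B4Ineq120RegularAmbient (inclι inclι_injective
  fine_sub pOp_incl)
open Literature.MathematicalPhysics.QuantumFieldTheory.Balaban1983to89.B4TorusRegionOp
open Literature.MathematicalPhysics.QuantumFieldTheory.Balaban1983to89.B4Ineq111ZeroNestEta (ThmPrintedNN)
open Literature.MathematicalPhysics.QuantumFieldTheory.Balaban1983to89.B4ThmRegionPairEta (Kmod)
open Literature.MathematicalPhysics.QuantumFieldTheory.Balaban1983to89.B4TorusPairFam (torusPairFam)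
open Literature.MathematicalPhysics.QuantumFieldTheory.Balaban1983to89.B4ThmTorusPairEta (thmPrintedNN_torusPairFam)
open Literature.MathematicalPhysics.QuantumFieldTheory.Balaban1983to89.B4Prop31Regular (regularFormSetting
  prop31Printed_regularRegion)
open Literature.MathematicalPhysics.QuantumFieldTheory.Balaban1983to89.B4Sect5Proof (sect5ThmUniform_holds)
open Literature.MathematicalPhysics.QuantumFieldTheory.Balaban1983to89.B4Ineq115TorusRegular (form115_lower_torus
  form115_upper_torus fineDom_subset_perBox gk_torus_eq)
open Literature.MathematicalPhysics.QuantumFieldTheory.Balaban1983to89.B4Prop23TorusRegular (rhoT rhoT_isPseudoDist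
  rhoT_sumBound sdistT rhoT_le_sdistT rhoT_le_of_pOp_ne_zero hamT_isSymm)
open Literature.MathematicalPhysics.QuantumFieldTheory.Balaban1983to89.B4Ineq120TorusRegular (gM0T ham0T ham0T_isSymm
  gk_ham0T deltaK_inclT form115_lower_ambientT omegaT sdcT omegaT_nonneg omegaT_lip omegaT_le_sdcT cor23_torus_setForm)

noncomputable section

variable {d : ℕ} {ι : Type} [Fintype ι] [DecidableEq ι]

/-! ## §1. Window constants; weakening (5.6) and (5.9) to them -/

/-- the lower end of the window of the running coefficient: `a_k = aSeq a L k > a(1 − L^{−2}) ≥ a₋(1 − L^{−2})`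
([Balaban1982Higgs1] (2.15); `L = ℓ+1`). [cite: Balaban1983RegularityDecay, (1.14) p.573 «a_k is a constant proportional to a»] -/
def aminW (ℓ : ℕ) (amin : ℝ) : ℝ := amin * (1 - ((((ℓ : ℝ) + 1)) ^ 2)⁻¹)

/-- the (5.6)/(5.9) constant at the window: `(a₊²c₀ + a′L^{−2} + a₊)e^{3δ₀(L+1)}` (dominates the three a_k-dependent
constants of files 2–3). [cite: Balaban1983RegularityDecay, (5.4)–(5.5) pp.593–594, (5.6), (5.9) p.594] -/
def cW56 (ℓ : ℕ) (aplus a' c₀ δ₀ : ℝ) : ℝ :=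
  (aplus ^ 2 * (c₀ * (1 * 1)) + a' * ((((ℓ + 1 : ℕ) : ℝ)) ^ 2)⁻¹ + aplus)
    * Real.exp (3 * (δ₀ * ((((ℓ + 1 : ℕ) : ℝ)) + 1)))

/-- `0 < a₋(1 − L^{−2})` for `a₋ > 0`, `L = ℓ+1 ≥ 2`. [cite: Balaban1983RegularityDecay, (1.14) p.573, dictionary] -/
theorem aminW_pos {ℓ : ℕ} (hℓ : 1 ≤ ℓ) {amin : ℝ} (ham : 0 < amin) : 0 < aminW ℓ amin := by
  unfold aminW
  have hL : (2 : ℝ) ≤ (ℓ : ℝ) + 1 := by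
    have : (1 : ℝ) ≤ ℓ := by exact_mod_cast hℓ
    linarith
  have h1 : ((((ℓ : ℝ) + 1)) ^ 2)⁻¹ < 1 := by
    rw [inv_lt_one_iff₀]
    right
    nlinarith
  exact mul_pos ham (by linarith)

/-- the running coefficient lies in the window: `a₋(1 − L^{−2}) ≤ aSeq a L k ≤ a₊` for `a ∈ [a₋,a₊]`, `ℓ ≥ 1`, `k ≥ 1`.
[cite: Balaban1983RegularityDecay, (1.14) p.573 «a_k is a constant proportional to a»] -/
theorem aSeq_mem_window {ℓ : ℕ} (hℓ : 1 ≤ ℓ) {amin aplus a : ℝ} (ham : 0 < amin) (h1 : amin ≤ a) (h2 : a ≤ aplus)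
    {k : ℕ} (hk : 1 ≤ k) :
    aminW ℓ amin ≤ B1.aSeq a ((ℓ : ℝ) + 1) k ∧ B1.aSeq a ((ℓ : ℝ) + 1) k ≤ aplus := by
  have ha : 0 < a := ham.trans_le h1
  have hL : (1 : ℝ) < (ℓ : ℝ) + 1 := by
    have : (1 : ℝ) ≤ ℓ := by exact_mod_cast hℓ
    linarith
  have hlow := B1.ainf_lt_aSeq ha hL k hk
  have hr : 0 ≤ 1 - ((((ℓ : ℝ) + 1)) ^ 2)⁻¹ := by
    have : ((((ℓ : ℝ) + 1)) ^ 2)⁻¹ ≤ 1 := inv_le_one_of_one_le₀ (by nlinarith)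
    linarith
  refine ⟨?_, (B1.aSeq_le ha hL k hk).trans h2⟩
  unfold aminW
  exact (mul_le_mul_of_nonneg_right h1 hr).trans hlow.le

/-- `cW56 > 0` for `c₀ ≥ 0`, `a′ > 0`. [cite: Balaban1983RegularityDecay, (5.6) p.594] -/
theorem cW56_pos (ℓ : ℕ) {aplus a' c₀ : ℝ} (hap : 0 ≤ aplus) (ha' : 0 < a') (hc₀ : 0 ≤ c₀) (δ₀ : ℝ) :
    0 < cW56 ℓ aplus a' c₀ δ₀ := by
  unfold cW56
  have hL : (0 : ℝ) < (((ℓ + 1 : ℕ) : ℝ)) := by positivity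
  have : 0 < a' * ((((ℓ + 1 : ℕ) : ℝ)) ^ 2)⁻¹ := by positivity
  have : 0 ≤ aplus ^ 2 * (c₀ * (1 * 1)) := by positivity
  exact mul_pos (by linarith) (Real.exp_pos _)

/-- the (5.4)-constant at `a_k` is below the window constant. [cite: Balaban1983RegularityDecay, (5.4) p.593, (5.6) p.594] -/
theorem c54_le_cW56 (ℓ : ℕ) {aplus a' c₀ δ₀ a : ℝ} (ha0 : 0 ≤ a) (ha : a ≤ aplus) (ha' : 0 ≤ a') (hc₀ : 0 ≤ c₀)
    (hδ₀ : 0 ≤ δ₀) {r : ℝ} (hr0 : 0 ≤ r) (hr : r ≤ (((ℓ + 1 : ℕ) : ℝ)) + 1) :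
    (a ^ 2 * (c₀ * (1 * 1)) + a' * ((((ℓ + 1 : ℕ) : ℝ)) ^ 2)⁻¹ + a) * Real.exp (δ₀ * r) ≤ cW56 ℓ aplus a' c₀ δ₀ := by
  unfold cW56
  have h1 : a ^ 2 * (c₀ * (1 * 1)) + a' * ((((ℓ + 1 : ℕ) : ℝ)) ^ 2)⁻¹ + a
      ≤ aplus ^ 2 * (c₀ * (1 * 1)) + a' * ((((ℓ + 1 : ℕ) : ℝ)) ^ 2)⁻¹ + aplus := by
    have : a ^ 2 ≤ aplus ^ 2 := pow_le_pow_left₀ ha0 ha 2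
    nlinarith
  have h2 : Real.exp (δ₀ * r) ≤ Real.exp (3 * (δ₀ * ((((ℓ + 1 : ℕ) : ℝ)) + 1))) :=
    Real.exp_le_exp.2 (by nlinarith [mul_le_mul_of_nonneg_left hr hδ₀, mul_nonneg hδ₀ hr0])
  have h0 : 0 ≤ a ^ 2 * (c₀ * (1 * 1)) + a' * ((((ℓ + 1 : ℕ) : ℝ)) ^ 2)⁻¹ + a := by positivity
  exact mul_le_mul h1 h2 (Real.exp_pos _).le (h0.trans h1)

/-- the (5.5)-constant at `a_k` is below the window constant. [cite: Balaban1983RegularityDecay, (5.5) p.594, (5.9) p.594] -/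
theorem c55_le_cW56 (ℓ : ℕ) {aplus a' c₀ δ₀ a : ℝ} (ha0 : 0 ≤ a) (ha : a ≤ aplus) (ha' : 0 ≤ a') (hc₀ : 0 ≤ c₀) :
    a ^ 2 * (c₀ * (1 * 1)) * Real.exp (3 * (δ₀ * ((((ℓ + 1 : ℕ) : ℝ)) + 1))) ≤ cW56 ℓ aplus a' c₀ δ₀ := by
  unfold cW56
  refine mul_le_mul_of_nonneg_right ?_ (Real.exp_pos _).le
  have : a ^ 2 ≤ aplus ^ 2 := pow_le_pow_left₀ ha0 ha 2
  have : 0 ≤ a' * ((((ℓ + 1 : ℕ) : ℝ)) ^ 2)⁻¹ := by positivity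
  nlinarith

/-- weakening the constants of (5.6) (lower bound down, kernel constant up, same rate). [cite: Balaban1983RegularityDecay, (5.6) p.594] -/
private theorem hyp56_weaken {Y : Type} [Fintype Y] [DecidableEq Y] {ρ : Y → Y → ℝ} {A : Matrix Y Y ℝ}
    {γ c δ γ' c' : ℝ} (h : Hyp56 ρ A γ c δ) (hγ : γ' ≤ γ) (hc : c ≤ c') : Hyp56 ρ A γ' c' δ := by
  refine ⟨h.1, fun v => le_trans ?_ (h.2.1 v), fun p q => (h.2.2 p q).trans ?_⟩
  · exact mul_le_mul_of_nonneg_right hγ (Finset.sum_nonneg fun p _ => sq_nonneg (v p))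
  · exact mul_le_mul_of_nonneg_right hc (Real.exp_pos _).le

/-- weakening the constant of (5.9) (same rate). [cite: Balaban1983RegularityDecay, (5.9) p.594] -/
private theorem hyp59_weaken {Y : Type} [Fintype Y] [DecidableEq Y] {ρ : Y → Y → ℝ} {ω : Y → ℝ} {B : Matrix Y Y ℝ}
    {c δ c' : ℝ} (h : Hyp59 ρ ω B c δ) (hc : c ≤ c') : Hyp59 ρ ω B c' δ := fun p q =>
  (h p q).trans (mul_le_mul_of_nonneg_right hc (Real.exp_pos _).le)

/-! ## §2. (1.15)–(1.20) on the torus at ONE instance with the WINDOW constants, given the three Corollary-2.3 inputs -/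

section Window

variable (F : OrthFlow ι) {ℓ₁ : ℝ} (hℓ₁ : 0 ≤ ℓ₁)
  (hLip : ∀ t (v : ι → ℝ), ((F.U t - 1) *ᵥ v) ⬝ᵥ ((F.U t - 1) *ᵥ v) ≤ (ℓ₁ * t) ^ 2 * (v ⬝ᵥ v))
  {ℓ : ℕ} (hℓ : 1 ≤ ℓ) {amin aplus m2plus : ℝ} (ham : 0 < amin) {a' : ℝ} (ha' : 0 < a') {creg β : ℝ} (hcreg : 0 ≤ creg)
  {k : ℕ} (hk : 1 ≤ k) {P' : Fin (d + 1) → ℕ} (hP' : ∀ ν, 1 ≤ P' ν) {ZcT Z₀cT : Finset (Fin (d + 1) → ℤ)}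
  (hsub : ZcT ⊆ Z₀cT) (hZ₀ : Z₀cT ⊆ boxDom P') (h3 : ∀ ν, 3 ≤ per ((ℓ + 1) ^ k) (per (ℓ + 1) P') ν)
  {a₀ m2 : ℝ} (ha1 : amin ≤ a₀) (ha2 : a₀ ≤ aplus) (hm1 : 0 ≤ m2) (hm2 : m2 ≤ m2plus)
  {Ac : (Fin (d + 1) → ℤ) → Fin (d + 1) → ℝ} {e : ℝ} (he : 0 < e)
  (hreg : ∀ x ∈ fineDom ((ℓ + 1) ^ k) (fineDom (ℓ + 1) Z₀cT), ∀ μ ν : Fin (d + 1),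
    |Ac (twrap ((ℓ + 1) ^ k) (per (ℓ + 1) P') (x + e1 μ)) ν - Ac x ν| ≤ creg * e ^ (β - 1) / ((ℓ + 1) ^ k : ℕ))
  (hsmall : ℓ₁ ^ 2 * ((d + 1) * creg * e ^ β) ^ 2 * (d + 1) * (1 + B1.aSeq a₀ ((ℓ : ℝ) + 1) k * (d + 1))
    ≤ min 2 (B1.aSeq a₀ ((ℓ : ℝ) + 1) k) / 4)
  (hsmallU : ℓ₁ ^ 2 * ((d + 1) * ((((ℓ + 1 : ℕ) : ℝ)) ^ 2 * creg) * e ^ β) ^ 2 * (d + 1)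
    * (1 + (a' / gam0 d (B1.aSeq a₀ ((ℓ : ℝ) + 1) k) m2plus) * (d + 1))
    ≤ min 2 (a' / gam0 d (B1.aSeq a₀ ((ℓ : ℝ) + 1) k) m2plus) / 4)
  (hXW : gam0 d (B1.aSeq a₀ ((ℓ : ℝ) + 1) k) m2
    * (6 * (d + 1) * (B1.aSeq a₀ ((ℓ : ℝ) + 1) k / (min 2 (B1.aSeq a₀ ((ℓ : ℝ) + 1) k) / 4 + m2)) ^ 2
      * (ℓ₁ * ((3 * d + 4) * creg * e ^ β)) ^ 2)
    ≤ gamLow d (ℓ + 1) (aminW ℓ amin) a' m2plus)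
  {c₀ δ₀ : ℝ} (hc₀ : 0 < c₀) (hδ₀ : 0 < δ₀)
  (hG : ∀ (g g' : ↥(fineDom ((ℓ + 1) ^ k) (fineDom (ℓ + 1) ZcT)) × ι → ℝ)
      (U U' : Finset (↥(fineDom ((ℓ + 1) ^ k) (fineDom (ℓ + 1) ZcT)) × ι)),
      (∀ x ∉ U, g x = 0) → (∀ x ∉ U', g' x = 0) →
      |g ⬝ᵥ ((torusOp F e (Nat.one_le_pow k (ℓ + 1) (Nat.succ_pos ℓ)) (B1.aSeq a₀ ((ℓ : ℝ) + 1) k) m2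
          (per (ℓ + 1) P') (fineDom (ℓ + 1) ZcT) Ac)⁻¹ *ᵥ g')|
        ≤ c₀ * bl2n g * bl2n g' * Real.exp (-(δ₀ * sdistT ((ℓ + 1) ^ k) (ℓ + 1) P' ZcT U U')))
  (hG0 : ∀ (g g' : ↥(fineDom ((ℓ + 1) ^ k) (fineDom (ℓ + 1) ZcT)) × ι → ℝ)
      (U U' : Finset (↥(fineDom ((ℓ + 1) ^ k) (fineDom (ℓ + 1) ZcT)) × ι)),
      (∀ x ∉ U, g x = 0) → (∀ x ∉ U', g' x = 0) →
      |g ⬝ᵥ (gM0T F e (Nat.one_le_pow k (ℓ + 1) (Nat.succ_pos ℓ)) (Nat.succ_le_succ (Nat.zero_le ℓ))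
          (B1.aSeq a₀ ((ℓ : ℝ) + 1) k) m2 P' hsub Ac *ᵥ g')|
        ≤ c₀ * bl2n g * bl2n g' * Real.exp (-(δ₀ * sdistT ((ℓ + 1) ^ k) (ℓ + 1) P' ZcT U U')))
  (hGd : ∀ (g g' : ↥(fineDom ((ℓ + 1) ^ k) (fineDom (ℓ + 1) ZcT)) × ι → ℝ)
      (U U' : Finset (↥(fineDom ((ℓ + 1) ^ k) (fineDom (ℓ + 1) ZcT)) × ι)),
      (∀ x ∉ U, g x = 0) → (∀ x ∉ U', g' x = 0) →
      |g ⬝ᵥ (((torusOp F e (Nat.one_le_pow k (ℓ + 1) (Nat.succ_pos ℓ)) (B1.aSeq a₀ ((ℓ : ℝ) + 1) k) m2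
          (per (ℓ + 1) P') (fineDom (ℓ + 1) ZcT) Ac)⁻¹
          - gM0T F e (Nat.one_le_pow k (ℓ + 1) (Nat.succ_pos ℓ)) (Nat.succ_le_succ (Nat.zero_le ℓ))
            (B1.aSeq a₀ ((ℓ : ℝ) + 1) k) m2 P' hsub Ac) *ᵥ g')|
        ≤ c₀ * bl2n g * bl2n g' * Real.exp (-(δ₀ * (sdistT ((ℓ + 1) ^ k) (ℓ + 1) P' ZcT U U'
            + sdcT ((ℓ + 1) ^ k) (ℓ + 1) P' ZcT U + sdcT ((ℓ + 1) ^ k) (ℓ + 1) P' ZcT U'))))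

include hℓ₁ hLip hℓ ham ha' hcreg hk hP' hZ₀ h3 ha1 ha2 hm1 hm2 he hreg hsmall hsmallU hXW hc₀ hδ₀ hG hG0 hGd in
/-- **(1.15)–(1.20) ON THE TORUS AT ONE INSTANCE WITH THE WINDOW CONSTANTS** `γ₀ = γ₀″(a₋(1−L⁻²))`, `γ₁ = a₊ + a′L^{−2}`,
`c₁ = cSt`, `δ₁ = dSt` of the Sect. 5 Theorem at `(N·K_{d+1}, γ₀, cW56, δ₀)` — INDEPENDENT of the instance's `a_k`, `k`,
torus, regions and field: (5.6) for both operators and (5.9) at the instance's constants (files 1–3, r01's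
`hyp56_kOp` ∕ `abs_kOp_apply_le_exp` ∕ `abs_deltaK_sub_apply_le_exp` ∕ `hyp59_deltaK_sub`) WEAKENED to the window
constants (`gamLow_mono`, `c54_le_cW56`, `c55_le_cW56`), then r01's kernel-proved Sect. 5 Theorem `prop23_of_sect5` ONCE.
[cite: Balaban1983RegularityDecay, Prop. 2.3 of [1] (1.15)–(1.20) p.574 «constants dependent on d and M only»; (5.3)–(5.5) pp.593–594; Sect. 5 Theorem p.594] -/
theorem prop23_window_torus (Λ : Finset (↥(fineDom (ℓ + 1) ZcT) × ι)) :
    (∀ ψ : ↥(fineDom (ℓ + 1) ZcT) × ι → ℝ,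
      gamLow d (ℓ + 1) (aminW ℓ amin) a' m2plus * (ψ ⬝ᵥ ψ)
        ≤ ψ ⬝ᵥ ((B4GaussRep36.deltaK (covLap (torWt ((ℓ + 1) ^ k) (per (ℓ + 1) P') (fineDom ((ℓ + 1) ^ k)
            (fineDom (ℓ + 1) ZcT))) (fieldLink F (e / ((ℓ + 1) ^ k : ℕ))
              fun u v : ↥(fineDom ((ℓ + 1) ^ k) (fineDom (ℓ + 1) ZcT)) => torBond ((ℓ + 1) ^ k) (per (ℓ + 1) P') Ac u.1 v.1)
            + m2 • (1 : Matrix _ _ ℝ)) (B1.aSeq a₀ ((ℓ : ℝ) + 1) k)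
            (QkR F e (Nat.one_le_pow k (ℓ + 1) (Nat.succ_pos ℓ)) (fineDom (ℓ + 1) ZcT)
              (perField ((ℓ + 1) ^ k) (per (ℓ + 1) P') Ac))
          + (a' * ((((ℓ + 1 : ℕ) : ℝ)) ^ 2)⁻¹) • pOp ((((ℓ + 1) ^ (d + 1) : ℕ) : ℝ))
              (nextAvg F (e / ((ℓ + 1) ^ k : ℕ)) (Nat.succ_le_succ (Nat.zero_le ℓ)) ZcT ((ℓ + 1) ^ k)
                (perField ((ℓ + 1) ^ k) (per (ℓ + 1) P') Ac))) *ᵥ ψ) ∧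
      ψ ⬝ᵥ ((B4GaussRep36.deltaK (covLap (torWt ((ℓ + 1) ^ k) (per (ℓ + 1) P') (fineDom ((ℓ + 1) ^ k)
            (fineDom (ℓ + 1) ZcT))) (fieldLink F (e / ((ℓ + 1) ^ k : ℕ))
              fun u v : ↥(fineDom ((ℓ + 1) ^ k) (fineDom (ℓ + 1) ZcT)) => torBond ((ℓ + 1) ^ k) (per (ℓ + 1) P') Ac u.1 v.1)
            + m2 • (1 : Matrix _ _ ℝ)) (B1.aSeq a₀ ((ℓ : ℝ) + 1) k)
            (QkR F e (Nat.one_le_pow k (ℓ + 1) (Nat.succ_pos ℓ)) (fineDom (ℓ + 1) ZcT)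
              (perField ((ℓ + 1) ^ k) (per (ℓ + 1) P') Ac))
          + (a' * ((((ℓ + 1 : ℕ) : ℝ)) ^ 2)⁻¹) • pOp ((((ℓ + 1) ^ (d + 1) : ℕ) : ℝ))
              (nextAvg F (e / ((ℓ + 1) ^ k : ℕ)) (Nat.succ_le_succ (Nat.zero_le ℓ)) ZcT ((ℓ + 1) ^ k)
                (perField ((ℓ + 1) ^ k) (per (ℓ + 1) P') Ac))) *ᵥ ψ)
        ≤ (aplus + a' * ((((ℓ + 1 : ℕ) : ℝ)) ^ 2)⁻¹) * (ψ ⬝ᵥ ψ)) ∧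
    (∀ y y' : Λ, |cLam (covLap (torWt ((ℓ + 1) ^ k) (per (ℓ + 1) P') (fineDom ((ℓ + 1) ^ k) (fineDom (ℓ + 1) ZcT)))
          (fieldLink F (e / ((ℓ + 1) ^ k : ℕ)) fun u v : ↥(fineDom ((ℓ + 1) ^ k) (fineDom (ℓ + 1) ZcT)) =>
            torBond ((ℓ + 1) ^ k) (per (ℓ + 1) P') Ac u.1 v.1)
          + m2 • (1 : Matrix _ _ ℝ)) (B1.aSeq a₀ ((ℓ : ℝ) + 1) k)
          (QkR F e (Nat.one_le_pow k (ℓ + 1) (Nat.succ_pos ℓ)) (fineDom (ℓ + 1) ZcT) (perField ((ℓ + 1) ^ k) (per (ℓ + 1) P') Ac))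
          a' ((((ℓ + 1 : ℕ) : ℝ) ^ 2)⁻¹) ((((ℓ + 1) ^ (d + 1) : ℕ) : ℝ))
          (nextAvg F (e / ((ℓ + 1) ^ k : ℕ)) (Nat.succ_le_succ (Nat.zero_le ℓ)) ZcT ((ℓ + 1) ^ k)
            (perField ((ℓ + 1) ^ k) (per (ℓ + 1) P') Ac)) Λ y y'|
        ≤ cSt (profK ι d) (gamLow d (ℓ + 1) (aminW ℓ amin) a' m2plus) (cW56 ℓ aplus a' c₀ δ₀) δ₀ *
          Real.exp (-(dSt (profK ι d) (gamLow d (ℓ + 1) (aminW ℓ amin) a' m2plus) (cW56 ℓ aplus a' c₀ δ₀) δ₀ *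
            rhoT (ℓ + 1) P' ZcT y.1 y'.1))) ∧
    (∀ βw : Λ → ℝ, (∀ y, 0 ≤ βw y) → (∀ (y : Λ) (z : ↥(fineDom (ℓ + 1) ZcT) × ι), z ∉ Λ → βw y ≤ rhoT (ℓ + 1) P' ZcT y.1 z) →
      ∀ y y' : Λ, |cLam (covLap (torWt ((ℓ + 1) ^ k) (per (ℓ + 1) P') (fineDom ((ℓ + 1) ^ k) (fineDom (ℓ + 1) ZcT)))
            (fieldLink F (e / ((ℓ + 1) ^ k : ℕ)) fun u v : ↥(fineDom ((ℓ + 1) ^ k) (fineDom (ℓ + 1) ZcT)) =>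
              torBond ((ℓ + 1) ^ k) (per (ℓ + 1) P') Ac u.1 v.1)
            + m2 • (1 : Matrix _ _ ℝ)) (B1.aSeq a₀ ((ℓ : ℝ) + 1) k)
            (QkR F e (Nat.one_le_pow k (ℓ + 1) (Nat.succ_pos ℓ)) (fineDom (ℓ + 1) ZcT) (perField ((ℓ + 1) ^ k) (per (ℓ + 1) P') Ac))
            a' ((((ℓ + 1 : ℕ) : ℝ) ^ 2)⁻¹) ((((ℓ + 1) ^ (d + 1) : ℕ) : ℝ))
            (nextAvg F (e / ((ℓ + 1) ^ k : ℕ)) (Nat.succ_le_succ (Nat.zero_le ℓ)) ZcT ((ℓ + 1) ^ k)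
              (perField ((ℓ + 1) ^ k) (per (ℓ + 1) P') Ac)) Λ y y'
          - (B4GaussRep36.deltaK (covLap (torWt ((ℓ + 1) ^ k) (per (ℓ + 1) P')
                (fineDom ((ℓ + 1) ^ k) (fineDom (ℓ + 1) ZcT)))
              (fieldLink F (e / ((ℓ + 1) ^ k : ℕ)) fun u v : ↥(fineDom ((ℓ + 1) ^ k) (fineDom (ℓ + 1) ZcT)) =>
                torBond ((ℓ + 1) ^ k) (per (ℓ + 1) P') Ac u.1 v.1)
              + m2 • (1 : Matrix _ _ ℝ)) (B1.aSeq a₀ ((ℓ : ℝ) + 1) k)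
              (QkR F e (Nat.one_le_pow k (ℓ + 1) (Nat.succ_pos ℓ)) (fineDom (ℓ + 1) ZcT)
                (perField ((ℓ + 1) ^ k) (per (ℓ + 1) P') Ac))
              + (a' * ((((ℓ + 1 : ℕ) : ℝ)) ^ 2)⁻¹) • pOp ((((ℓ + 1) ^ (d + 1) : ℕ) : ℝ))
                  (nextAvg F (e / ((ℓ + 1) ^ k : ℕ)) (Nat.succ_le_succ (Nat.zero_le ℓ)) ZcT ((ℓ + 1) ^ k)
                    (perField ((ℓ + 1) ^ k) (per (ℓ + 1) P') Ac)))⁻¹ y y'|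
        ≤ cSt (profK ι d) (gamLow d (ℓ + 1) (aminW ℓ amin) a' m2plus) (cW56 ℓ aplus a' c₀ δ₀) δ₀ *
          Real.exp (-(dSt (profK ι d) (gamLow d (ℓ + 1) (aminW ℓ amin) a' m2plus) (cW56 ℓ aplus a' c₀ δ₀) δ₀ *
            (rhoT (ℓ + 1) P' ZcT y.1 y'.1 + βw y + βw y')))) ∧
    (∀ y y' : Λ, |cLam (covLap (torWt ((ℓ + 1) ^ k) (per (ℓ + 1) P') (fineDom ((ℓ + 1) ^ k) (fineDom (ℓ + 1) ZcT)))
            (fieldLink F (e / ((ℓ + 1) ^ k : ℕ)) fun u v : ↥(fineDom ((ℓ + 1) ^ k) (fineDom (ℓ + 1) ZcT)) =>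
              torBond ((ℓ + 1) ^ k) (per (ℓ + 1) P') Ac u.1 v.1)
            + m2 • (1 : Matrix _ _ ℝ)) (B1.aSeq a₀ ((ℓ : ℝ) + 1) k)
            (QkR F e (Nat.one_le_pow k (ℓ + 1) (Nat.succ_pos ℓ)) (fineDom (ℓ + 1) ZcT) (perField ((ℓ + 1) ^ k) (per (ℓ + 1) P') Ac))
            a' ((((ℓ + 1 : ℕ) : ℝ) ^ 2)⁻¹) ((((ℓ + 1) ^ (d + 1) : ℕ) : ℝ))
            (nextAvg F (e / ((ℓ + 1) ^ k : ℕ)) (Nat.succ_le_succ (Nat.zero_le ℓ)) ZcT ((ℓ + 1) ^ k)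
              (perField ((ℓ + 1) ^ k) (per (ℓ + 1) P') Ac)) Λ y y'
          - cLam (ham0T F e (Nat.one_le_pow k (ℓ + 1) (Nat.succ_pos ℓ)) (Nat.succ_le_succ (Nat.zero_le ℓ))
              (B1.aSeq a₀ ((ℓ : ℝ) + 1) k) m2 P' hsub Ac) (B1.aSeq a₀ ((ℓ : ℝ) + 1) k)
            (QkR F e (Nat.one_le_pow k (ℓ + 1) (Nat.succ_pos ℓ)) (fineDom (ℓ + 1) ZcT) (perField ((ℓ + 1) ^ k) (per (ℓ + 1) P') Ac))
            a' ((((ℓ + 1 : ℕ) : ℝ) ^ 2)⁻¹) ((((ℓ + 1) ^ (d + 1) : ℕ) : ℝ))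
            (nextAvg F (e / ((ℓ + 1) ^ k : ℕ)) (Nat.succ_le_succ (Nat.zero_le ℓ)) ZcT ((ℓ + 1) ^ k)
              (perField ((ℓ + 1) ^ k) (per (ℓ + 1) P') Ac)) Λ y y'|
        ≤ cSt (profK ι d) (gamLow d (ℓ + 1) (aminW ℓ amin) a' m2plus) (cW56 ℓ aplus a' c₀ δ₀) δ₀ *
          Real.exp (-(dSt (profK ι d) (gamLow d (ℓ + 1) (aminW ℓ amin) a' m2plus) (cW56 ℓ aplus a' c₀ δ₀) δ₀ *
            (rhoT (ℓ + 1) P' ZcT y.1 y'.1 + omegaT (ℓ + 1) P' ZcT y.1 + omegaT (ℓ + 1) P' ZcT y'.1)))) := by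
  -- bookkeeping
  have hL1 : 1 ≤ ℓ + 1 := Nat.succ_le_succ (Nat.zero_le ℓ)
  have hn1 : 1 ≤ (ℓ + 1) ^ k := Nat.one_le_pow k (ℓ + 1) (Nat.succ_pos ℓ)
  have hLr : (0 : ℝ) ≤ (((ℓ + 1 : ℕ) : ℝ)) + 1 := by positivity
  have hw : ((((ℓ + 1) ^ (d + 1) : ℕ) : ℝ)) ≠ 0 := by
    have : 0 < (ℓ + 1) ^ (d + 1) := pow_pos (Nat.succ_pos ℓ) _
    exact_mod_cast this.ne'
  have hwin := aSeq_mem_window hℓ ham ha1 ha2 hk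
  have hamW := aminW_pos hℓ ham
  have hak : 0 < B1.aSeq a₀ ((ℓ : ℝ) + 1) k := hamW.trans_le hwin.1
  have hm0 : 0 ≤ m2plus := hm1.trans hm2
  have hZ : ZcT ⊆ boxDom P' := hsub.trans hZ₀
  have hΩ : fineDom (ℓ + 1) ZcT ⊆ boxDom (per (ℓ + 1) P') := fineDom_subset_perBox hL1 ZcT hZ
  have hregΩ : ∀ x ∈ fineDom ((ℓ + 1) ^ k) (fineDom (ℓ + 1) ZcT), ∀ μ ν : Fin (d + 1),
      |Ac (twrap ((ℓ + 1) ^ k) (per (ℓ + 1) P') (x + e1 μ)) ν - Ac x ν| ≤ creg * e ^ (β - 1) / ((ℓ + 1) ^ k : ℕ) :=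
    fun x hx => hreg x (fine_sub hn1 hL1 hsub hx)
  have hγmono : gamLow d (ℓ + 1) (aminW ℓ amin) a' m2plus ≤ gamLow d (ℓ + 1) (B1.aSeq a₀ ((ℓ : ℝ) + 1) k) a' m2plus :=
    gamLow_mono d (ℓ + 1) hamW hwin.1 hm0
  have hX : gam0 d (B1.aSeq a₀ ((ℓ : ℝ) + 1) k) m2
      * (6 * (d + 1) * (B1.aSeq a₀ ((ℓ : ℝ) + 1) k / (min 2 (B1.aSeq a₀ ((ℓ : ℝ) + 1) k) / 4 + m2)) ^ 2
        * (ℓ₁ * ((3 * d + 4) * creg * e ^ β)) ^ 2)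
      ≤ gamLow d (ℓ + 1) (B1.aSeq a₀ ((ℓ : ℝ) + 1) k) a' m2plus := hXW.trans hγmono
  have hγ : 0 < gamLow d (ℓ + 1) (aminW ℓ amin) a' m2plus := gamLow_pos d hL1 _ ha' m2plus
  have hcW : 0 < cW56 ℓ aplus a' c₀ δ₀ := cW56_pos ℓ (ham.le.trans (ha1.trans ha2)) ha' hc₀.le δ₀
  -- the three Corollary-2.3 inputs in r01's `gk`-form
  have hG' : ∀ (g g' : ↥(fineDom ((ℓ + 1) ^ k) (fineDom (ℓ + 1) ZcT)) × ι → ℝ)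
      (U U' : Finset (↥(fineDom ((ℓ + 1) ^ k) (fineDom (ℓ + 1) ZcT)) × ι)),
      (∀ x ∉ U, g x = 0) → (∀ x ∉ U', g' x = 0) →
      |g ⬝ᵥ (gk (covLap (torWt ((ℓ + 1) ^ k) (per (ℓ + 1) P') (fineDom ((ℓ + 1) ^ k) (fineDom (ℓ + 1) ZcT)))
          (fieldLink F (e / ((ℓ + 1) ^ k : ℕ)) fun u v : ↥(fineDom ((ℓ + 1) ^ k) (fineDom (ℓ + 1) ZcT)) =>
            torBond ((ℓ + 1) ^ k) (per (ℓ + 1) P') Ac u.1 v.1)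
          + m2 • (1 : Matrix _ _ ℝ)) (B1.aSeq a₀ ((ℓ : ℝ) + 1) k)
          (QkR F e hn1 (fineDom (ℓ + 1) ZcT) (perField ((ℓ + 1) ^ k) (per (ℓ + 1) P') Ac)) *ᵥ g')|
        ≤ c₀ * bl2n g * bl2n g' * Real.exp (-(δ₀ * sdistT ((ℓ + 1) ^ k) (ℓ + 1) P' ZcT U U')) := by
    intro g g' U U' hg hg'
    rw [gk_torus_eq F e hn1 h3 hΩ Ac (B1.aSeq a₀ ((ℓ : ℝ) + 1) k) m2]
    exact hG g g' U U' hg hg'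
  have hG0' : ∀ (g g' : ↥(fineDom ((ℓ + 1) ^ k) (fineDom (ℓ + 1) ZcT)) × ι → ℝ)
      (U U' : Finset (↥(fineDom ((ℓ + 1) ^ k) (fineDom (ℓ + 1) ZcT)) × ι)),
      (∀ x ∉ U, g x = 0) → (∀ x ∉ U', g' x = 0) →
      |g ⬝ᵥ (gk (ham0T F e hn1 hL1 (B1.aSeq a₀ ((ℓ : ℝ) + 1) k) m2 P' hsub Ac) (B1.aSeq a₀ ((ℓ : ℝ) + 1) k)
          (QkR F e hn1 (fineDom (ℓ + 1) ZcT) (perField ((ℓ + 1) ^ k) (per (ℓ + 1) P') Ac)) *ᵥ g')|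
        ≤ c₀ * bl2n g * bl2n g' * Real.exp (-(δ₀ * sdistT ((ℓ + 1) ^ k) (ℓ + 1) P' ZcT U U')) := by
    intro g g' U U' hg hg'
    rw [gk_ham0T F e hn1 hL1 P' hsub Ac hak hm1 hZ₀]
    exact hG0 g g' U U' hg hg'
  have hGd' : ∀ (g g' : ↥(fineDom ((ℓ + 1) ^ k) (fineDom (ℓ + 1) ZcT)) × ι → ℝ)
      (U U' : Finset (↥(fineDom ((ℓ + 1) ^ k) (fineDom (ℓ + 1) ZcT)) × ι)),
      (∀ x ∉ U, g x = 0) → (∀ x ∉ U', g' x = 0) →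
      |g ⬝ᵥ ((gk (covLap (torWt ((ℓ + 1) ^ k) (per (ℓ + 1) P') (fineDom ((ℓ + 1) ^ k) (fineDom (ℓ + 1) ZcT)))
          (fieldLink F (e / ((ℓ + 1) ^ k : ℕ)) fun u v : ↥(fineDom ((ℓ + 1) ^ k) (fineDom (ℓ + 1) ZcT)) =>
            torBond ((ℓ + 1) ^ k) (per (ℓ + 1) P') Ac u.1 v.1)
          + m2 • (1 : Matrix _ _ ℝ)) (B1.aSeq a₀ ((ℓ : ℝ) + 1) k)
          (QkR F e hn1 (fineDom (ℓ + 1) ZcT) (perField ((ℓ + 1) ^ k) (per (ℓ + 1) P') Ac))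
        - gk (ham0T F e hn1 hL1 (B1.aSeq a₀ ((ℓ : ℝ) + 1) k) m2 P' hsub Ac) (B1.aSeq a₀ ((ℓ : ℝ) + 1) k)
          (QkR F e hn1 (fineDom (ℓ + 1) ZcT) (perField ((ℓ + 1) ^ k) (per (ℓ + 1) P') Ac))) *ᵥ g')|
        ≤ c₀ * bl2n g * bl2n g' * Real.exp (-(δ₀ * (sdistT ((ℓ + 1) ^ k) (ℓ + 1) P' ZcT U U'
            + sdcT ((ℓ + 1) ^ k) (ℓ + 1) P' ZcT U + sdcT ((ℓ + 1) ^ k) (ℓ + 1) P' ZcT U'))) := by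
    intro g g' U U' hg hg'
    rw [gk_torus_eq F e hn1 h3 hΩ Ac (B1.aSeq a₀ ((ℓ : ℝ) + 1) k) m2, gk_ham0T F e hn1 hL1 P' hsub Ac hak hm1 hZ₀]
    exact hGd g g' U U' hg hg'
  -- geometry inputs with slack `r = L + 1`
  have hρS : ∀ p q : ↥(fineDom (ℓ + 1) ZcT) × ι, rhoT (ℓ + 1) P' ZcT p q
      ≤ sdistT ((ℓ + 1) ^ k) (ℓ + 1) P' ZcT (suppK ZcT hn1 p) (suppK ZcT hn1 q) + ((((ℓ + 1 : ℕ) : ℝ)) + 1) :=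
    fun p q => (rhoT_le_sdistT hn1 hL1 hP' ZcT p q).trans (by push_cast; linarith)
  have hρP : ∀ p q : ↥(fineDom (ℓ + 1) ZcT) × ι,
      pOp ((((ℓ + 1) ^ (d + 1) : ℕ) : ℝ)) (nextAvg F (e / ((ℓ + 1) ^ k : ℕ)) hL1 ZcT ((ℓ + 1) ^ k)
        (perField ((ℓ + 1) ^ k) (per (ℓ + 1) P') Ac)) p q ≠ 0 →
      rhoT (ℓ + 1) P' ZcT p q ≤ (((ℓ + 1 : ℕ) : ℝ)) + 1 :=
    fun p q h => (rhoT_le_of_pOp_ne_zero hL1 hP' ZcT F (e / ((ℓ + 1) ^ k : ℕ))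
      (perField ((ℓ + 1) ^ k) (per (ℓ + 1) P') Ac) p q h).trans (by push_cast; linarith)
  have hρ0 : ∀ p : ↥(fineDom (ℓ + 1) ZcT) × ι, rhoT (ℓ + 1) P' ZcT p p ≤ (((ℓ + 1 : ℕ) : ℝ)) + 1 := fun p => by
    rw [(rhoT_isPseudoDist (ι := ι) hL1 hP' ZcT).zero]; exact hLr
  have hP1 := fun p q => abs_pOp_le_one (rowOrtho_nextAvg F (e / ((ℓ + 1) ^ k : ℕ)) hL1 ZcT ((ℓ + 1) ^ k)
    (perField ((ℓ + 1) ^ k) (per (ℓ + 1) P') Ac)) hw p q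
  have hωS : ∀ p : ↥(fineDom (ℓ + 1) ZcT) × ι,
      omegaT (ℓ + 1) P' ZcT p ≤ sdcT ((ℓ + 1) ^ k) (ℓ + 1) P' ZcT (suppK ZcT hn1 p) + ((((ℓ + 1 : ℕ) : ℝ)) + 1) :=
    fun p => (omegaT_le_sdcT hn1 hL1 hP' ZcT p).trans (by linarith)
  -- (5.6) for the operator of `Ω`, window constants
  have h56 := hyp56_weaken
    (hyp56_kOp (ρ := rhoT (ℓ + 1) P' ZcT) (hamT_isSymm F e hn1 h3 hΩ Ac hak hm1)
      (form115_lower_torus F hn1 hL1 ZcT hZ h3 hℓ₁ hLip he hak ha' hm1 hm2 hcreg hregΩ hsmall hsmallU hX)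
      (abs_kOp_apply_le_exp (suppK ZcT hn1)
        (QkR_row_support ZcT hn1 F e (perField ((ℓ + 1) ^ k) (per (ℓ + 1) P') Ac))
        (QkR_row_sq ZcT hn1 F e (perField ((ℓ + 1) ^ k) (per (ℓ + 1) P') Ac))
        bl2n_sq zero_le_one hc₀.le zero_le_one hak.le (by positivity) hG' hδ₀.le hρS hρP hρ0 hP1))
    hγmono (c54_le_cW56 ℓ hak.le hwin.2 ha'.le hc₀.le hδ₀.le hLr le_rfl)
  -- (5.6) for the ambient operator, window constants
  have h56₀ := hyp56_weaken
    (hyp56_kOp (ρ := rhoT (ℓ + 1) P' ZcT) (ham0T_isSymm F e hn1 hL1 P' hsub Ac hak hm1 hZ₀)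
      (form115_lower_ambientT F e hn1 hL1 hak hm1 hsub hZ₀ h3 Ac
        (form115_lower_torus F hn1 hL1 Z₀cT hZ₀ h3 hℓ₁ hLip he hak ha' hm1 hm2 hcreg hreg hsmall hsmallU hX))
      (abs_kOp_apply_le_exp (suppK ZcT hn1)
        (QkR_row_support ZcT hn1 F e (perField ((ℓ + 1) ^ k) (per (ℓ + 1) P') Ac))
        (QkR_row_sq ZcT hn1 F e (perField ((ℓ + 1) ^ k) (per (ℓ + 1) P') Ac))
        bl2n_sq zero_le_one hc₀.le zero_le_one hak.le (by positivity) hG0' hδ₀.le hρS hρP hρ0 hP1))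
    hγmono (c54_le_cW56 ℓ hak.le hwin.2 ha'.le hc₀.le hδ₀.le hLr le_rfl)
  -- (5.9), window constant
  have h59 := hyp59_weaken
    (hyp59_deltaK_sub (ρ := rhoT (ℓ + 1) P' ZcT) (ω := omegaT (ℓ + 1) P' ZcT) fun y y' =>
      abs_deltaK_sub_apply_le_exp (suppK ZcT hn1)
        (QkR_row_support ZcT hn1 F e (perField ((ℓ + 1) ^ k) (per (ℓ + 1) P') Ac))
        (QkR_row_sq ZcT hn1 F e (perField ((ℓ + 1) ^ k) (per (ℓ + 1) P') Ac))
        bl2n_sq zero_le_one hc₀.le zero_le_one hGd' hδ₀.le hρS hωS y y')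
    (c55_le_cW56 ℓ hak.le hwin.2 ha'.le hc₀.le)
  -- the Sect. 5 Theorem, once
  have H := prop23_of_sect5 (K := profK ι d) (profK_nonneg (ι := ι)) hγ hcW hδ₀
    (rhoT_isPseudoDist (ι := ι) hL1 hP' ZcT) (rhoT_sumBound (ι := ι) hL1 hP' ZcT hZ) h56 Λ
  refine ⟨fun ψ => ⟨?_, ?_⟩, H.1, H.2.1, fun y y' => ?_⟩
  · have hψ : 0 ≤ ψ ⬝ᵥ ψ := by
      rw [dotProduct]; exact Finset.sum_nonneg fun p _ => mul_self_nonneg (ψ p)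
    exact (mul_le_mul_of_nonneg_right hγmono hψ).trans
      (form115_lower_torus F hn1 hL1 ZcT hZ h3 hℓ₁ hLip he hak ha' hm1 hm2 hcreg hregΩ hsmall hsmallU hX ψ)
  · have hψ : 0 ≤ ψ ⬝ᵥ ψ := by
      rw [dotProduct]; exact Finset.sum_nonneg fun p _ => mul_self_nonneg (ψ p)
    exact (form115_upper_torus F hn1 hL1 ZcT hZ h3 hak ha'.le hm1 Ac ψ).trans
      (mul_le_mul_of_nonneg_right (by linarith [hwin.2]) hψ)
  · exact H.2.2 _ _ h56₀ (omegaT_nonneg (P' := P') ZcT) (omegaT_lip hL1 hP' ZcT) h59 y y'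

end Window

/-! ## §3. The family of regular-field nested torus regions: index, carrier, the ambient re-indexing -/

/-- **`dist_T(y, Λ^c)`** read inside `Ω^{(k)} × {colours}`: the least torus distance from `y` to a site–colour pair outside
`Λ` (`0` if `Λ` is everything). [cite: Balaban1983RegularityDecay, (1.18) p.574 «dist(x, Λ^c)»; p.572 (torus)] -/
def tdistCT {ℓ : ℕ} (P' : Fin (d + 1) → ℕ) {ZcT : Finset (Fin (d + 1) → ℤ)} (Λ : Finset (↥(fineDom (ℓ + 1) ZcT) × ι))
    (y : ↥(fineDom (ℓ + 1) ZcT) × ι) : ℝ :=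
  sInf ((fun z => rhoT (ℓ + 1) P' ZcT y z) '' {z | z ∉ Λ})

omit [Fintype ι] [DecidableEq ι] in
/-- `dist_T(y, Λ^c) ≥ 0`. [cite: Balaban1983RegularityDecay, (1.18) p.574] -/
theorem tdistCT_nonneg {ℓ : ℕ} (hℓ1 : 1 ≤ ℓ + 1) {P' : Fin (d + 1) → ℕ} (hP' : ∀ ν, 1 ≤ P' ν)
    {ZcT : Finset (Fin (d + 1) → ℤ)} (Λ : Finset (↥(fineDom (ℓ + 1) ZcT) × ι)) (y : ↥(fineDom (ℓ + 1) ZcT) × ι) :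
    0 ≤ tdistCT P' Λ y := by
  unfold tdistCT
  apply Real.sInf_nonneg
  rintro _ ⟨z, -, rfl⟩
  exact (rhoT_isPseudoDist (ι := ι) hℓ1 hP' ZcT).nonneg y z

omit [Fintype ι] [DecidableEq ι] in
/-- `dist_T(y, Λ^c) ≤ |y − z|_T` for `z ∉ Λ`. [cite: Balaban1983RegularityDecay, (1.18) p.574] -/
theorem tdistCT_le {ℓ : ℕ} (hℓ1 : 1 ≤ ℓ + 1) {P' : Fin (d + 1) → ℕ} (hP' : ∀ ν, 1 ≤ P' ν)
    {ZcT : Finset (Fin (d + 1) → ℤ)} (Λ : Finset (↥(fineDom (ℓ + 1) ZcT) × ι)) (y : ↥(fineDom (ℓ + 1) ZcT) × ι)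
    {z : ↥(fineDom (ℓ + 1) ZcT) × ι} (hz : z ∉ Λ) : tdistCT P' Λ y ≤ rhoT (ℓ + 1) P' ZcT y z := by
  unfold tdistCT
  exact csInf_le ⟨0, by rintro _ ⟨w, -, rfl⟩; exact (rhoT_isPseudoDist (ι := ι) hℓ1 hP' ZcT).nonneg y w⟩ ⟨z, hz, rfl⟩

/-- ONE INSTANCE of «Proposition 2.3 of [1]» on the torus at a regular field: scale `k ≥ 1` (mesh `L^k`); a unit torus
`Π_ν ℤ/(L·P′_ν)` (`P′_ν ≥ 1`, fine period `≥ 3`); nested unions `Ω^{(k)} ⊆ Ω₀^{(k)}` of its `L`-blocks (labels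
`Z_T ⊆ Z₀_T ⊆ Π_ν[0,P′_ν)`); a finite `Λ ⊆ Ω^{(k)} × {colours}`; `a ∈ [a₋,a₊]` (running coefficient `a_k = aSeq a L k`);
`m² ∈ [0,m²₊]`; the torus field; the charge. [cite: Balaban1983RegularityDecay, (1.13)–(1.20) pp.573–574; p.572 (torus); dictionary] -/
structure TorusRegIdxW (d : ℕ) (ι : Type) (ℓ : ℕ) (amin aplus m2plus : ℝ) where
  /-- the scale -/
  k : ℕ
  hk : 1 ≤ k
  /-- the unit torus: `P′_ν` blocks of side `L` per direction -/
  P' : Fin (d + 1) → ℕ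
  hP' : ∀ ν, 1 ≤ P' ν
  h3 : ∀ ν, 3 ≤ per ((ℓ + 1) ^ k) (per (ℓ + 1) P') ν
  /-- the `L`-block labels of `Ω^{(k)} ⊆ Ω₀^{(k)}` -/
  ZcT : Finset (Fin (d + 1) → ℤ)
  Z₀cT : Finset (Fin (d + 1) → ℤ)
  hsub : ZcT ⊆ Z₀cT
  hZ₀ : Z₀cT ⊆ boxDom P'
  /-- `Λ ⊆ Ω^{(k)} × {colours}` -/
  Λ : Finset (↥(fineDom (ℓ + 1) ZcT) × ι)
  /-- the coefficient `a` and the mass -/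
  a₀ : ℝ
  m2 : ℝ
  ha1 : amin ≤ a₀
  ha2 : a₀ ≤ aplus
  hm1 : 0 ≤ m2
  hm2 : m2 ≤ m2plus
  /-- the torus field on the fine period box and the charge -/
  Ac : (Fin (d + 1) → ℤ) → Fin (d + 1) → ℝ
  e : ℝ

/-- **THE REGULAR-FIELD NESTED TORUS-REGION CARRIERS OF `B4.UnitSetting`** (module docstring, THE FAMILY): the TORUS
`famU` for the DAG leaf `b4`. [cite: Balaban1983RegularityDecay, (1.13)–(1.14) p.573, Prop. 2.3 of [1] (1.15)–(1.20) p.574, (1.7) p.572, p.572 «operators on subsets of a torus T_η»; dictionary] -/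
def torusFieldRegionsW (F : OrthFlow ι) (ℓ : ℕ) (amin aplus m2plus a' creg β : ℝ)
    (i : TorusRegIdxW d ι ℓ amin aplus m2plus) : B4.UnitSetting where
  LSite := ↥i.Λ
  e := i.e
  regular := ∀ x ∈ fineDom ((ℓ + 1) ^ i.k) (fineDom (ℓ + 1) i.Z₀cT), ∀ μ ν : Fin (d + 1),
    |i.Ac (twrap ((ℓ + 1) ^ i.k) (per (ℓ + 1) i.P') (x + e1 μ)) ν - i.Ac x ν| ≤ creg * i.e ^ (β - 1) / ((ℓ + 1) ^ i.k : ℕ)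
  bigBlocks := True
  udist := fun y y' => rhoT (ℓ + 1) i.P' i.ZcT y.1 y'.1
  distLc := fun y => tdistCT i.P' i.Λ y.1
  distOc := fun y => omegaT (ℓ + 1) i.P' i.ZcT y.1
  kerC := fun y y' => |cLam (covLap (torWt ((ℓ + 1) ^ i.k) (per (ℓ + 1) i.P') (fineDom ((ℓ + 1) ^ i.k)
      (fineDom (ℓ + 1) i.ZcT))) (fieldLink F (i.e / ((ℓ + 1) ^ i.k : ℕ))
        fun u v : ↥(fineDom ((ℓ + 1) ^ i.k) (fineDom (ℓ + 1) i.ZcT)) => torBond ((ℓ + 1) ^ i.k) (per (ℓ + 1) i.P') i.Ac u.1 v.1)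
      + i.m2 • (1 : Matrix _ _ ℝ)) (B1.aSeq i.a₀ ((ℓ : ℝ) + 1) i.k)
      (QkR F i.e (Nat.one_le_pow i.k (ℓ + 1) (Nat.succ_pos ℓ)) (fineDom (ℓ + 1) i.ZcT)
        (perField ((ℓ + 1) ^ i.k) (per (ℓ + 1) i.P') i.Ac))
      a' ((((ℓ + 1 : ℕ) : ℝ) ^ 2)⁻¹) ((((ℓ + 1) ^ (d + 1) : ℕ) : ℝ))
      (nextAvg F (i.e / ((ℓ + 1) ^ i.k : ℕ)) (Nat.succ_le_succ (Nat.zero_le ℓ)) i.ZcT ((ℓ + 1) ^ i.k)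
        (perField ((ℓ + 1) ^ i.k) (per (ℓ + 1) i.P') i.Ac)) i.Λ y y'|
  kerDC := fun y y' => |cLam (covLap (torWt ((ℓ + 1) ^ i.k) (per (ℓ + 1) i.P') (fineDom ((ℓ + 1) ^ i.k)
      (fineDom (ℓ + 1) i.ZcT))) (fieldLink F (i.e / ((ℓ + 1) ^ i.k : ℕ))
        fun u v : ↥(fineDom ((ℓ + 1) ^ i.k) (fineDom (ℓ + 1) i.ZcT)) => torBond ((ℓ + 1) ^ i.k) (per (ℓ + 1) i.P') i.Ac u.1 v.1)
      + i.m2 • (1 : Matrix _ _ ℝ)) (B1.aSeq i.a₀ ((ℓ : ℝ) + 1) i.k)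
      (QkR F i.e (Nat.one_le_pow i.k (ℓ + 1) (Nat.succ_pos ℓ)) (fineDom (ℓ + 1) i.ZcT)
        (perField ((ℓ + 1) ^ i.k) (per (ℓ + 1) i.P') i.Ac))
      a' ((((ℓ + 1 : ℕ) : ℝ) ^ 2)⁻¹) ((((ℓ + 1) ^ (d + 1) : ℕ) : ℝ))
      (nextAvg F (i.e / ((ℓ + 1) ^ i.k : ℕ)) (Nat.succ_le_succ (Nat.zero_le ℓ)) i.ZcT ((ℓ + 1) ^ i.k)
        (perField ((ℓ + 1) ^ i.k) (per (ℓ + 1) i.P') i.Ac)) i.Λ y y'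
    - (B4GaussRep36.deltaK (covLap (torWt ((ℓ + 1) ^ i.k) (per (ℓ + 1) i.P') (fineDom ((ℓ + 1) ^ i.k)
        (fineDom (ℓ + 1) i.ZcT))) (fieldLink F (i.e / ((ℓ + 1) ^ i.k : ℕ))
          fun u v : ↥(fineDom ((ℓ + 1) ^ i.k) (fineDom (ℓ + 1) i.ZcT)) => torBond ((ℓ + 1) ^ i.k) (per (ℓ + 1) i.P') i.Ac u.1 v.1)
        + i.m2 • (1 : Matrix _ _ ℝ)) (B1.aSeq i.a₀ ((ℓ : ℝ) + 1) i.k)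
        (QkR F i.e (Nat.one_le_pow i.k (ℓ + 1) (Nat.succ_pos ℓ)) (fineDom (ℓ + 1) i.ZcT)
          (perField ((ℓ + 1) ^ i.k) (per (ℓ + 1) i.P') i.Ac))
      + (a' * ((((ℓ + 1 : ℕ) : ℝ)) ^ 2)⁻¹) • pOp ((((ℓ + 1) ^ (d + 1) : ℕ) : ℝ))
        (nextAvg F (i.e / ((ℓ + 1) ^ i.k : ℕ)) (Nat.succ_le_succ (Nat.zero_le ℓ)) i.ZcT ((ℓ + 1) ^ i.k)
          (perField ((ℓ + 1) ^ i.k) (per (ℓ + 1) i.P') i.Ac)))⁻¹ y.1 y'.1|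
  kerDC0 := fun y y' => |cLam (covLap (torWt ((ℓ + 1) ^ i.k) (per (ℓ + 1) i.P') (fineDom ((ℓ + 1) ^ i.k)
      (fineDom (ℓ + 1) i.ZcT))) (fieldLink F (i.e / ((ℓ + 1) ^ i.k : ℕ))
        fun u v : ↥(fineDom ((ℓ + 1) ^ i.k) (fineDom (ℓ + 1) i.ZcT)) => torBond ((ℓ + 1) ^ i.k) (per (ℓ + 1) i.P') i.Ac u.1 v.1)
      + i.m2 • (1 : Matrix _ _ ℝ)) (B1.aSeq i.a₀ ((ℓ : ℝ) + 1) i.k)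
      (QkR F i.e (Nat.one_le_pow i.k (ℓ + 1) (Nat.succ_pos ℓ)) (fineDom (ℓ + 1) i.ZcT)
        (perField ((ℓ + 1) ^ i.k) (per (ℓ + 1) i.P') i.Ac))
      a' ((((ℓ + 1 : ℕ) : ℝ) ^ 2)⁻¹) ((((ℓ + 1) ^ (d + 1) : ℕ) : ℝ))
      (nextAvg F (i.e / ((ℓ + 1) ^ i.k : ℕ)) (Nat.succ_le_succ (Nat.zero_le ℓ)) i.ZcT ((ℓ + 1) ^ i.k)
        (perField ((ℓ + 1) ^ i.k) (per (ℓ + 1) i.P') i.Ac)) i.Λ y y'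
    - cLam (covLap (torWt ((ℓ + 1) ^ i.k) (per (ℓ + 1) i.P') (fineDom ((ℓ + 1) ^ i.k)
      (fineDom (ℓ + 1) i.Z₀cT))) (fieldLink F (i.e / ((ℓ + 1) ^ i.k : ℕ))
        fun u v : ↥(fineDom ((ℓ + 1) ^ i.k) (fineDom (ℓ + 1) i.Z₀cT)) => torBond ((ℓ + 1) ^ i.k) (per (ℓ + 1) i.P') i.Ac u.1 v.1)
      + i.m2 • (1 : Matrix _ _ ℝ)) (B1.aSeq i.a₀ ((ℓ : ℝ) + 1) i.k)
      (QkR F i.e (Nat.one_le_pow i.k (ℓ + 1) (Nat.succ_pos ℓ)) (fineDom (ℓ + 1) i.Z₀cT)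
        (perField ((ℓ + 1) ^ i.k) (per (ℓ + 1) i.P') i.Ac))
      a' ((((ℓ + 1 : ℕ) : ℝ) ^ 2)⁻¹) ((((ℓ + 1) ^ (d + 1) : ℕ) : ℝ))
      (nextAvg F (i.e / ((ℓ + 1) ^ i.k : ℕ)) (Nat.succ_le_succ (Nat.zero_le ℓ)) i.Z₀cT ((ℓ + 1) ^ i.k)
        (perField ((ℓ + 1) ^ i.k) (per (ℓ + 1) i.P') i.Ac)) (i.Λ.map (embY (Nat.succ_le_succ (Nat.zero_le ℓ)) i.hsub))
      (lamEquiv (Nat.succ_le_succ (Nat.zero_le ℓ)) i.hsub i.Λ y) (lamEquiv (Nat.succ_le_succ (Nat.zero_le ℓ)) i.hsub i.Λ y')|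
  form115 := fun γ₀ γ₁ => ∀ ψ : ↥(fineDom (ℓ + 1) i.ZcT) × ι → ℝ,
    γ₀ * (ψ ⬝ᵥ ψ) ≤ ψ ⬝ᵥ ((B4GaussRep36.deltaK (covLap (torWt ((ℓ + 1) ^ i.k) (per (ℓ + 1) i.P')
        (fineDom ((ℓ + 1) ^ i.k) (fineDom (ℓ + 1) i.ZcT))) (fieldLink F (i.e / ((ℓ + 1) ^ i.k : ℕ))
          fun u v : ↥(fineDom ((ℓ + 1) ^ i.k) (fineDom (ℓ + 1) i.ZcT)) => torBond ((ℓ + 1) ^ i.k) (per (ℓ + 1) i.P') i.Ac u.1 v.1)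
        + i.m2 • (1 : Matrix _ _ ℝ)) (B1.aSeq i.a₀ ((ℓ : ℝ) + 1) i.k)
        (QkR F i.e (Nat.one_le_pow i.k (ℓ + 1) (Nat.succ_pos ℓ)) (fineDom (ℓ + 1) i.ZcT)
          (perField ((ℓ + 1) ^ i.k) (per (ℓ + 1) i.P') i.Ac))
      + (a' * ((((ℓ + 1 : ℕ) : ℝ)) ^ 2)⁻¹) • pOp ((((ℓ + 1) ^ (d + 1) : ℕ) : ℝ))
        (nextAvg F (i.e / ((ℓ + 1) ^ i.k : ℕ)) (Nat.succ_le_succ (Nat.zero_le ℓ)) i.ZcT ((ℓ + 1) ^ i.k)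
          (perField ((ℓ + 1) ^ i.k) (per (ℓ + 1) i.P') i.Ac))) *ᵥ ψ) ∧
    ψ ⬝ᵥ ((B4GaussRep36.deltaK (covLap (torWt ((ℓ + 1) ^ i.k) (per (ℓ + 1) i.P')
        (fineDom ((ℓ + 1) ^ i.k) (fineDom (ℓ + 1) i.ZcT))) (fieldLink F (i.e / ((ℓ + 1) ^ i.k : ℕ))
          fun u v : ↥(fineDom ((ℓ + 1) ^ i.k) (fineDom (ℓ + 1) i.ZcT)) => torBond ((ℓ + 1) ^ i.k) (per (ℓ + 1) i.P') i.Ac u.1 v.1)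
        + i.m2 • (1 : Matrix _ _ ℝ)) (B1.aSeq i.a₀ ((ℓ : ℝ) + 1) i.k)
        (QkR F i.e (Nat.one_le_pow i.k (ℓ + 1) (Nat.succ_pos ℓ)) (fineDom (ℓ + 1) i.ZcT)
          (perField ((ℓ + 1) ^ i.k) (per (ℓ + 1) i.P') i.Ac))
      + (a' * ((((ℓ + 1 : ℕ) : ℝ)) ^ 2)⁻¹) • pOp ((((ℓ + 1) ^ (d + 1) : ℕ) : ℝ))
        (nextAvg F (i.e / ((ℓ + 1) ^ i.k : ℕ)) (Nat.succ_le_succ (Nat.zero_le ℓ)) i.ZcT ((ℓ + 1) ^ i.k)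
          (perField ((ℓ + 1) ^ i.k) (per (ℓ + 1) i.P') i.Ac))) *ᵥ ψ) ≤ γ₁ * (ψ ⬝ᵥ ψ)

section Ambient

variable (F : OrthFlow ι) (e : ℝ) {n L : ℕ} (hn : 1 ≤ n) (hL : 1 ≤ L) {a m2 : ℝ} (ha : 0 < a) (hm : 0 ≤ m2)
  {P' : Fin (d + 1) → ℕ} {ZcT Z₀cT : Finset (Fin (d + 1) → ℤ)} (hsub : ZcT ⊆ Z₀cT) (hZ₀ : Z₀cT ⊆ boxDom P')
  (h3 : ∀ ν, 3 ≤ per n (per L P') ν) (Ac : (Fin (d + 1) → ℤ) → Fin (d + 1) → ℝ)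

include ha hm hZ₀ h3 in
/-- **`C^{(k)}_{ιΛ}(Ω₀,A)(ιy, ιy′) = (cLam H₀ … Λ)(y, y′)` ON THE TORUS**: the propagator (1.13) of `Ω₀` at `ιΛ`, built on
`Ω₀`'s own torus carriers, is entry-wise r01's `cLam` with the ambient form matrix `ham0T` on `Ω`'s carriers (entry
identities `deltaK_inclT`, `pOp_incl`; re-indexing of the inverse along `Λ ≃ ιΛ`) — torus twin of p17's `cLam_ambient_eq`.
[cite: Balaban1983RegularityDecay, (1.13)–(1.14) p.573, (1.19) p.574; p.572 (torus)] -/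
theorem cLam_ambient_eqT (s w : ℝ) (Λ : Finset (↥(fineDom L ZcT) × ι)) (y y' : Λ) :
    cLam (covLap (torWt n (per L P') (fineDom n (fineDom L Z₀cT)))
        (fieldLink F (e / n) fun u v : ↥(fineDom n (fineDom L Z₀cT)) => torBond n (per L P') Ac u.1 v.1)
        + m2 • (1 : Matrix _ _ ℝ)) a (QkR F e hn (fineDom L Z₀cT) (perField n (per L P') Ac)) s (((L : ℝ) ^ 2)⁻¹) w
        (nextAvg F (e / n) hL Z₀cT n (perField n (per L P') Ac)) (Λ.map (embY hL hsub)) (lamEquiv hL hsub Λ y)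
        (lamEquiv hL hsub Λ y')
      = cLam (ham0T F e hn hL a m2 P' hsub Ac) a (QkR F e hn (fineDom L ZcT) (perField n (per L P') Ac)) s
        (((L : ℝ) ^ 2)⁻¹) w (nextAvg F (e / n) hL ZcT n (perField n (per L P') Ac)) Λ y y' := by
  have hK : (cOpLam (covLap (torWt n (per L P') (fineDom n (fineDom L Z₀cT)))
        (fieldLink F (e / n) fun u v : ↥(fineDom n (fineDom L Z₀cT)) => torBond n (per L P') Ac u.1 v.1)
        + m2 • (1 : Matrix _ _ ℝ)) a (QkR F e hn (fineDom L Z₀cT) (perField n (per L P') Ac)) s (((L : ℝ) ^ 2)⁻¹) w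
        (nextAvg F (e / n) hL Z₀cT n (perField n (per L P') Ac)) (Λ.map (embY hL hsub))).submatrix
        (lamEquiv hL hsub Λ) (lamEquiv hL hsub Λ)
      = cOpLam (ham0T F e hn hL a m2 P' hsub Ac) a (QkR F e hn (fineDom L ZcT) (perField n (per L P') Ac)) s
        (((L : ℝ) ^ 2)⁻¹) w (nextAvg F (e / n) hL ZcT n (perField n (per L P') Ac)) Λ := by
    have hE : ∀ r : Λ, ((lamEquiv hL hsub Λ r : ↥(Λ.map (embY (ι := ι) hL hsub))) : ↥(fineDom L Z₀cT) × ι)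
        = inclι (fineDom_mono hL hsub) r.1 := fun r => rfl
    ext p q
    unfold cOpLam
    rw [Matrix.submatrix_apply, Matrix.submatrix_apply, Matrix.submatrix_apply, hE, hE, Matrix.add_apply,
      Matrix.add_apply, Matrix.smul_apply, Matrix.smul_apply, deltaK_inclT F e hn hL ha hm hsub hZ₀ h3 Ac,
      pOp_incl F (e / n) hL hsub (perField n (per L P') Ac)]
  unfold cLam
  rw [← hK, Matrix.inv_submatrix_equiv]
  rfl

end Ambient

/-! ## §4. The leaf: `B4.Prop23Printed` on the torus family -/

section Leaf

variable (F : OrthFlow ι) {ℓ₁ : ℝ} (hℓ₁ : 0 ≤ ℓ₁)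
  (hLip : ∀ t (v : ι → ℝ), ((F.U t - 1) *ᵥ v) ⬝ᵥ ((F.U t - 1) *ᵥ v) ≤ (ℓ₁ * t) ^ 2 * (v ⬝ᵥ v))
  {ℓ : ℕ} (hℓ : 1 ≤ ℓ) {amin aplus m2plus : ℝ} (ham : 0 < amin) (hap : amin ≤ aplus) (hm0 : 0 ≤ m2plus)
  {a' : ℝ} (ha' : 0 < a') {creg β : ℝ} (hcreg : 0 ≤ creg) (hβ : 0 < β)

include hℓ₁ hLip hℓ ham hap hm0 ha' hcreg hβ in
/-- **LEAF: «PROPOSITION 2.3 OF [1]» (1.15)–(1.20) HOLDS ON THE FAMILY OF REGULAR-FIELD NESTED TORUS REGIONS (`A ≠ 0`)** —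
`B4.Prop23Printed (torusFieldRegionsW F ℓ a₋ a₊ m²₊ a′ c β)`: for a Lipschitz orthogonal flow, `L = ℓ+1 ≥ 2`,
`0 < a₋ ≤ a₊`, `m²₊ ≥ 0`, `a′ > 0`, `c ≥ 0`, `β > 0` THERE EXIST `δ₀, c₀, γ₀, γ₁, e₁ > 0` such that for EVERY instance —
every scale `k ≥ 1`, every unit torus, every nested pair `Ω ⊆ Ω₀` of unions of its `L`-blocks, EVERY `Λ ⊆ Ω^{(k)} ×
{colours}`, every `a ∈ [a₋,a₊]` (running coefficient `a_k = aSeq a L k`), every `m² ∈ [0,m²₊]`, every torus field regular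
(1.7) on `Ω₀`, every charge `0 < e ≤ e₁` — (1.15), (1.16), (1.17)–(1.18) and (1.19)–(1.20) hold: ONE invocation of r01 g10's
Corollary 2.3 on the torus (`cor23_torus_setForm`), p17's window thresholds (`threshold_window`, `thresholdU_window`,
`hX_window` over `[a₋(1−L⁻²), a₊]`), `prop23_window_torus`, and `cLam_ambient_eqT` for (1.19).
[cite: Balaban1983RegularityDecay, Prop. 2.3 of [1] (1.15)–(1.20) p.574; §5 pp.593–594; p.572 «operators on subsets of a torus T_η»] -/
theorem prop23Printed_torusRegionsW :
    B4.Prop23Printed (torusFieldRegionsW (d := d) F ℓ amin aplus m2plus a' creg β) := by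
  have hL1 : 1 ≤ ℓ + 1 := Nat.succ_le_succ (Nat.zero_le ℓ)
  have hamW := aminW_pos hℓ ham
  have hL1r : (1 : ℝ) < (ℓ : ℝ) + 1 := by
    have : (1 : ℝ) ≤ ℓ := by exact_mod_cast hℓ
    linarith
  have hamWle : aminW ℓ amin ≤ aplus := by
    have h := aSeq_mem_window hℓ ham le_rfl hap (k := 1) le_rfl
    exact h.1.trans h.2
  obtain ⟨c₀, δ₀, e₀, hc₀, hδ₀, he₀, HC⟩ :=
    cor23_torus_setForm (d := d) F hℓ₁ hLip ℓ hℓ amin aplus m2plus ham creg β hcreg hβ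
  obtain ⟨e₁, he₁, h₁⟩ := threshold_window ℓ₁ (((d : ℝ) + 1) * creg) hamW hamWle hβ d
  obtain ⟨e₂, he₂, h₂⟩ := thresholdU_window ℓ₁ (((d : ℝ) + 1) * ((((ℓ + 1 : ℕ) : ℝ)) ^ 2 * creg)) hamW hamWle ha' hβ d hm0
  obtain ⟨e₃, he₃, h₃⟩ := hX_window ℓ₁ creg hamW hamWle ha' hβ d (ℓ + 1) hL1 m2plus
  have hγ : 0 < gamLow d (ℓ + 1) (aminW ℓ amin) a' m2plus := gamLow_pos d hL1 _ ha' m2plus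
  have hcW : 0 < cW56 ℓ aplus a' c₀ δ₀ := cW56_pos ℓ (ham.le.trans hap) ha' hc₀.le δ₀
  have hK := profK_nonneg (ι := ι) (d := d)
  refine ⟨dSt (profK ι d) (gamLow d (ℓ + 1) (aminW ℓ amin) a' m2plus) (cW56 ℓ aplus a' c₀ δ₀) δ₀,
    cSt (profK ι d) (gamLow d (ℓ + 1) (aminW ℓ amin) a' m2plus) (cW56 ℓ aplus a' c₀ δ₀) δ₀,
    gamLow d (ℓ + 1) (aminW ℓ amin) a' m2plus, aplus + a' * ((((ℓ + 1 : ℕ) : ℝ)) ^ 2)⁻¹,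
    min e₀ (min e₁ (min e₂ e₃)), dSt_pos hK hγ hcW.le hδ₀, cSt_pos _ _ _ hγ, hγ,
    by have : 0 < aplus := ham.trans_le hap; positivity,
    lt_min he₀ (lt_min he₁ (lt_min he₂ he₃)), ?_⟩
  intro i hreg _ he hle
  change 0 < i.e at he
  change i.e ≤ _ at hle
  change ∀ x ∈ fineDom ((ℓ + 1) ^ i.k) (fineDom (ℓ + 1) i.Z₀cT), ∀ μ ν : Fin (d + 1),
    |i.Ac (twrap ((ℓ + 1) ^ i.k) (per (ℓ + 1) i.P') (x + e1 μ)) ν - i.Ac x ν| ≤ creg * i.e ^ (β - 1) / ((ℓ + 1) ^ i.k : ℕ)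
    at hreg
  have hwin := aSeq_mem_window hℓ ham i.ha1 i.ha2 i.hk
  -- the smallness hypotheses at the running coefficient of the instance
  have hsmall : ℓ₁ ^ 2 * ((d + 1) * creg * i.e ^ β) ^ 2 * (d + 1) * (1 + B1.aSeq i.a₀ ((ℓ : ℝ) + 1) i.k * (d + 1))
      ≤ min 2 (B1.aSeq i.a₀ ((ℓ : ℝ) + 1) i.k) / 4 := by
    have := h₁ i.e he (hle.trans ((min_le_right _ _).trans (min_le_left _ _))) _ hwin.1 hwin.2
    simpa only [mul_assoc] using this
  have hsmallU : ℓ₁ ^ 2 * ((d + 1) * ((((ℓ + 1 : ℕ) : ℝ)) ^ 2 * creg) * i.e ^ β) ^ 2 * (d + 1)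
      * (1 + (a' / gam0 d (B1.aSeq i.a₀ ((ℓ : ℝ) + 1) i.k) m2plus) * (d + 1))
      ≤ min 2 (a' / gam0 d (B1.aSeq i.a₀ ((ℓ : ℝ) + 1) i.k) m2plus) / 4 := by
    have := h₂ i.e he (hle.trans ((min_le_right _ _).trans ((min_le_right _ _).trans (min_le_left _ _)))) _
      hwin.1 hwin.2
    simpa only [mul_assoc] using this
  have hXW := h₃ i.e he (hle.trans ((min_le_right _ _).trans ((min_le_right _ _).trans (min_le_right _ _)))) _
    hwin.1 hwin.2 i.m2 i.hm1
  obtain ⟨hG, hG0, hGd⟩ := HC i.k i.hk i.P' i.hP' i.ZcT i.Z₀cT i.hsub i.hZ₀ i.h3 i.a₀ i.m2 i.ha1 i.ha2 i.hm1 i.hm2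
    i.Ac i.e hreg he (hle.trans (min_le_left _ _))
  have W := prop23_window_torus F hℓ₁ hLip hℓ ham ha' hcreg i.hk i.hP' i.hsub i.hZ₀ i.h3 i.ha1 i.ha2 i.hm1 i.hm2 he
    hreg hsmall hsmallU hXW hc₀ hδ₀ hG hG0 hGd i.Λ
  have hak : 0 < B1.aSeq i.a₀ ((ℓ : ℝ) + 1) i.k := hamW.trans_le hwin.1
  refine ⟨W.1, fun y y' => W.2.1 y y', fun y y' => ?_, fun y y' => ?_⟩
  · -- (1.17)–(1.18)
    exact W.2.2.1 (fun y => tdistCT i.P' i.Λ y.1) (fun y => tdistCT_nonneg hL1 i.hP' i.Λ y.1)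
      (fun y z hz => tdistCT_le hL1 i.hP' i.Λ y.1 hz) y y'
  · -- (1.19)–(1.20): the propagator of `Ω₀` on its own carriers IS the ambient one
    show |_ - cLam _ _ _ _ _ _ _ _ (lamEquiv hL1 i.hsub i.Λ y) (lamEquiv hL1 i.hsub i.Λ y')| ≤ _
    rw [cLam_ambient_eqT F i.e (Nat.one_le_pow i.k (ℓ + 1) (Nat.succ_pos ℓ)) hL1 hak i.hm1 i.hsub i.hZ₀ i.h3 i.Ac]
    exact W.2.2.2 y y'

/-- **THE FAMILY IS NON-VACUOUS AT EVERY THRESHOLD**: for every `e₁ > 0` there is an instance meeting `regular ∧ bigBlocks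
∧ 0 < e ≤ e₁` (scale `k = 1`, the torus with `P′_ν = 3`, `Ω = Ω₀ =` one `L`-block, `Λ = ∅`, `a = a₋`, `m² = 0`, zero
field, `e = e₁`; needs `a₋ ≤ a₊`, `0 ≤ m²₊`, `c ≥ 0`). [cite: Balaban1983RegularityDecay, Prop. 2.3 p.574 «for e sufficiently small» (non-vacuity bookkeeping)] -/
theorem torusRegionsW_nonvacuous {ℓ : ℕ} {amin aplus m2plus : ℝ} (hap : amin ≤ aplus) (hm0 : 0 ≤ m2plus)
    (a' : ℝ) {creg : ℝ} (hcreg : 0 ≤ creg) (β e₁ : ℝ) (he₁ : 0 < e₁) :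
    ∃ i : TorusRegIdxW d ι ℓ amin aplus m2plus,
      (torusFieldRegionsW F ℓ amin aplus m2plus a' creg β i).regular ∧
      (torusFieldRegionsW F ℓ amin aplus m2plus a' creg β i).bigBlocks ∧
      0 < (torusFieldRegionsW F ℓ amin aplus m2plus a' creg β i).e ∧
      (torusFieldRegionsW F ℓ amin aplus m2plus a' creg β i).e ≤ e₁ := by
  have h0 : ({0} : Finset (Fin (d + 1) → ℤ)) ⊆ boxDom (fun _ : Fin (d + 1) => 3) := by
    intro y hy
    rw [Finset.mem_singleton] at hy
    rw [hy, B4Reflection242.mem_boxDom]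
    intro i
    simp
  have h3 : ∀ ν : Fin (d + 1), 3 ≤ per ((ℓ + 1) ^ 1) (per (ℓ + 1) (fun _ : Fin (d + 1) => 3)) ν := by
    intro ν
    simp only [per, pow_one]
    have : 1 ≤ (ℓ + 1) * (ℓ + 1) := Nat.one_le_iff_ne_zero.2 (by positivity)
    nlinarith
  have hP3 : ∀ ν : Fin (d + 1), 1 ≤ (fun _ : Fin (d + 1) => (3 : ℕ)) ν := fun _ => by norm_num
  let i0 : TorusRegIdxW d ι ℓ amin aplus m2plus :=
    { k := 1, hk := le_rfl, P' := fun _ => 3, hP' := hP3, h3 := h3, ZcT := ({0} : Finset (Fin (d + 1) → ℤ)),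
      Z₀cT := ({0} : Finset (Fin (d + 1) → ℤ)), hsub := Finset.Subset.refl _, hZ₀ := h0, Λ := ∅, a₀ := amin, m2 := 0,
      ha1 := le_rfl, ha2 := hap, hm1 := le_rfl, hm2 := hm0, Ac := fun _ _ => 0, e := e₁ }
  refine ⟨i0, ?_, trivial, he₁, le_rfl⟩
  intro x _ μ ν
  show |(0 : ℝ) - 0| ≤ creg * e₁ ^ (β - 1) / (((ℓ + 1) ^ 1 : ℕ) : ℝ)
  rw [sub_self, abs_zero]
  have : (0 : ℝ) < ((ℓ + 1) ^ 1 : ℕ) := by positivity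
  exact div_nonneg (mul_nonneg hcreg (Real.rpow_nonneg he₁.le _)) this.le

end Leaf

/-! ## §5. The DAG leaf `b4` (NN form) with the TORUS `famU` -/

section DagLeaf

variable (F : OrthFlow ι) {ℓ₁ : ℝ} (hℓ₁ : 0 ≤ ℓ₁)
  (hLip : ∀ t (v : ι → ℝ), ((F.U t - 1) *ᵥ v) ⬝ᵥ ((F.U t - 1) *ᵥ v) ≤ (ℓ₁ * t) ^ 2 * (v ⬝ᵥ v))
  (d' ℓ : ℕ) (hℓ : 1 ≤ ℓ) (amin aplus m2plus : ℝ) (ham : 0 < amin) (hap : amin ≤ aplus) (hm0 : 0 ≤ m2plus)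
  (creg β : ℝ) (hcreg : 0 ≤ creg) (hβ : 0 < β) {a' : ℝ} (ha' : 0 < a')
  {a m2 C a₀ p : ℝ} (ha0 : 0 < a) (hm : 0 ≤ m2) (hC : 0 ≤ C) (ha₀ : 0 ≤ a₀) (hp : 0 < p) (d₅ N₅ : ℕ)

include hap hm0 hcreg hβ ha' ha0 hm hC ha₀ hp in
/-- **THE DAG LEAF `b4` IN ITS `0 ≤ α` FORM, ALL FOUR CONJUNCTS, WITH BOTH η-LEVEL FAMILIES ON THE TORUS**: Theorem p. 573
(1.9)–(1.12) on r01 g9's torus region pairs (`ThmPrintedNN (torusPairFam …)`, block size `Kmod`) ∧ «Proposition 2.3 of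
[1]» (1.15)–(1.20) ON THE TORUS famU of this module (`Prop23Printed (torusFieldRegionsW …)`) ∧ «Proposition 3.1′ of [2]»
(1.21)–(1.22) (p35's lattice form family, unchanged) ∧ the Sect. 5 Theorem — r01's `B4LeafRegular.leafNN_torusPairFam` with
its SECOND conjunct moved to the torus (the F-torusU flag of YM-PLAN row N01); this 4-tuple is the body of
`DagDischargedII.B4LeafNN` for these families. [cite: Balaban1983RegularityDecay, Theorem (1.9)–(1.12) p.573; Prop. 2.3 of [1] (1.15)–(1.20) p.574; Prop. 3.1′ of [2] (1.21)–(1.22) p.574; Sect. 5 Theorem p.594; p.572 (torus)] -/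
theorem leafNN_torusPairFam_torusU :
    ThmPrintedNN (torusPairFam F d' ℓ amin aplus m2plus creg β (Kmod F hℓ₁ hLip d' ℓ hℓ amin aplus m2plus ham)) ∧
    B4.Prop23Printed (torusFieldRegionsW (d := d') F ℓ amin aplus m2plus a' creg β) ∧
    B4.Prop31Printed (regularFormSetting (d := d') F a m2 C a₀ p) ∧
    B4.Sect5ThmUniform d₅ N₅ :=
  ⟨thmPrintedNN_torusPairFam F hℓ₁ hLip d' ℓ hℓ amin aplus m2plus ham creg β hcreg hβ,
   prop23Printed_torusRegionsW (d := d') F hℓ₁ hLip hℓ ham hap hm0 ha' hcreg hβ,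
   prop31Printed_regularRegion F hℓ₁ hLip ha0 hm hC ha₀ hp,
   sect5ThmUniform_holds d₅ N₅⟩

end DagLeaf

end

end Literature.MathematicalPhysics.QuantumFieldTheory.Balaban1983to89.B4Prop23TorusFamily
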